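import Literature.RingTheory.KTheory.MilnorWittKTheoryRatFuncExactSequence
import Literature.RingTheory.KTheory.MilnorWittKTheoryGrothendieckWitt
import Literature.RingTheory.KTheory.MilnorKWittRingRatFuncIdealPowersExact
import HarnessLib

/-!
# REMARK 3.26: Theorem 3.24 in negative degrees is Milnor's Theorem 5.3 — Morel's residues `∂^π_v` on
# `K^MW_{−n} = ηⁿW` are Milnor's second residue class form homomorphisms
# (F. Morel, *𝔸¹-Algebraic Topology over a Field*, LNM 2052 (2012), Ch. 3 §3.2, Remark 3.26, p. 64)

Family `hodge`, lane `lit-hodgefound` (foundations library; seat `lit-hodgefound-p27`, generation 44, row g44-#10);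
topic `RingTheory/KTheory`.  Joins the two formalised exact sequences for `F(T)`: Morel's THEOREM 3.24 for
Milnor–Witt K-theory (`MilnorWittKTheoryRatFuncExactSequence`, g44-#9: `constMap`, `ratResidue = ∂^P`, `psiRat`,
`forall_ratResidue_eq_zero_iff`, `exists_mem_deg_forall_ratResidue_eq`) and Milnor's THEOREM 5.3 for Witt rings
(`MilnorKWittRingRatFuncResidues`, g41/g42: `WittRing.constMapW`, `WittRing.boundaryAtW = ∂_P` the second residue,
`WittRing.retraction`), through Morel's `φ_{−n} : W(F) ≅ K^MW_{−n}(F)` (`MilnorWittKTheoryGrothendieckWitt`, g43-#3: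
`phiNeg`, `phiNeg_gen`, `phiNeg_injective`, `phiNeg_surjOn`) and the residue formulas of THEOREM 3.15
(`MilnorWittKTheoryResidue`, g43-#6: `residue_sym`, `residue_eta_pow_mul`; `MilnorKWittRingResidue`:
`sndResidue_gen_of_even/odd`, `rho_gen`, `WittRing.addMonoidHom_ext`).  PROVED THEOREMS only; no definition, no named
fact, no instance, no notation, 0 `sorry`, net debt 0 (D-0026).

## The source, verbatim

F. Morel, LNM 2052 (galaxy `panama:491790935261208`, p. 64; bib key `Morel2012`), Ch. 3 §3.2, after the proof of
Theorem 3.24: «REMARK 3.26. We observe that the previous theorem in negative degrees is exactly [53, Theorem 5.3].»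
([53] = J. Milnor, *Algebraic K-theory and quadratic forms*: «THEOREM 5.3. The sequence
0 → W(F) → W(F(t)) —(∂_π)→ ⊕_π W(F[t]/π) → 0 is split exact», with the second residue class form homomorphisms
`∂_π`, «∂(πu) = (ū), ∂(u) = 0» (Corollary 5.1).)  The dictionary: before Lemma 3.10 «we get an epimorphism
φ_{−n} : W(F) ↠ K^MW_{−n}(F), (a) ↦ ηⁿ<a>», an isomorphism by Lemma 3.10; and Lemma 3.16 «Θ_π(πⁿ.u) := [ū] + (n_ε<ū>).ξ»,
i.e. `∂^π_v([πⁿu]) = n_ε<ū>`.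

## What is formalised

* §1 the parity of `n_ε` after multiplication by `η`: `eta_mul_angle_neg_one` (`η<−1> = −η`), **`eta_mul_zneps`**
  (`η·n_ε = 0` for even `n ∈ ℤ`, `= η` for odd `n`; from `η·h = 0` and `(n+1)_ε = <−1>n_ε + 1`),
  `eta_pow_succ_mul_zneps_of_even/odd`.
* §2 for any discrete valuation `(v, π)` on a field `K` and `n ≥ 1`: `residue_angle` (`∂<x> = η·v(x)_ε·<x̄′>`),
  **`residue_eta_pow_mul_angle`** (`∂(ηⁿ<x>) = 0` for `v(x)` even, `= ηⁿ⁺¹<x̄′>` for `v(x)` odd — exactly Corollary 5.1's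
  `∂(u) = 0`, `∂(πu) = (ū)`), and **`residue_phiNeg : ∂^π_v ∘ φ_{−n} = φ_{−(n+1)} ∘ ∂_π`** on all of `W(K)`.
* §3 for `F(T)`: **`constMap_phiNeg`** (`ι ∘ φ_{−n} = φ_{−n} ∘ ι_W`), `evalZeroHom_comp_symm_eq` and
  **`psiRat_phiNeg`** (`ψ ∘ φ_{−n} = φ_{−n} ∘ r_W`: the retractions correspond), **`ratResidue_phiNeg`**
  (`∂^P ∘ φ_{−n} = φ_{−(n+1)} ∘ ∂_P` for every monic irreducible `P`), `forall_ratResidue_phiNeg_eq_zero_iff` /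
  `forall_boundaryAtW_eq_zero_iff_exists_constMap` (exactness in the middle of the two sequences is the same
  statement), `forall_boundaryAtW_eq_iff`, and **`exists_forall_boundaryAtW_eq_of_ratResidue`**: the surjectivity of
  Milnor's `Σ∂_P : W(F(T)) → ⊕_P W(κ_P)` DEDUCED from Theorem 3.24 in degree `−n` (homogeneous lifting
  `exists_mem_deg_forall_ratResidue_eq`, `phiNeg_surjOn`, `phiNeg_injective`).

So the three squares (constants, residues, retractions) between the degree-`−n` part of Theorem 3.24 and Theorem 5.3
commute, with vertical isomorphisms `φ_{−n}`, `φ_{−(n+1)}` (`phiNegEquiv`): «exactly [53, Theorem 5.3]».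
* §4 (row g44-#10b, theorems appended) the pay-off: Milnor's THEOREM 5.3 IN EVERY CHARACTERISTIC —
  **`witt_forall_boundaryAtW_eq_zero_iff`**, **`witt_bijective_retraction_prod_boundaryFamilyW`**,
  `witt_existsUnique_retraction_eq_zero_and_boundaryFamilyW_eq` — the tree's `WittRing.forall_boundaryAtW_eq_zero_iff` /
  `WittRing.bijective_retraction_prod_boundaryFamilyW` (g42-#2) carry `(2 : F) ≠ 0` because Milnor's Lemma 5.6 was
  built with `WittRing.liftAdd`; the route through `K^MW_{−1}` and Theorem 3.24 needs no such hypothesis.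
* §5 (row g44-#10c, theorems appended; import widened to `MilnorKWittRingRatFuncIdealPowersExact`) the same for
  Milnor's LEMMA 5.7 (`Iⁿ`-version): **`witt_exists_mem_pow_constMapW_eq`**,
  **`witt_bijOn_pow_retraction_prod_boundaryFamilyW`** without `(2 : F) ≠ 0`.

## References

* [Morel2012] F. Morel, *𝔸¹-Algebraic Topology over a Field*, Lecture Notes in Math. 2052, Springer (2012) — Ch. 3
  §3.2 Remark 3.26 (p. 64); before Lemma 3.10 (`φ_{−n}`); Lemma 3.16 / Theorem 3.15.
* [Milnor1970] J. Milnor, *Algebraic K-theory and quadratic forms*, Invent. Math. 9 (1970) 318–344 — §5 Corollary 5.1,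
  Theorem 5.3, Lemma 5.7.

Provenance: lane `lit-hodgefound`, seat `lit-hodgefound-p27` gen 44 (agent `literature-prover-lit-hodgefound-p27-g44-0`),
rows g44-#10 (§1–§3), g44-#10b (§4), g44-#10c (§5).
-/

set_option autoImplicit false

noncomputable section

namespace Literature.RingTheory.KTheory

namespace MilnorWittK

open Polynomial IsDedekindDomain

/-! ### §1 `η·n_ε`: `η·n_ε = 0` for `n` even, `= η` for `n` odd -/

section EtaZneps

variable (K : Type*) [Field K]

/-- `η·<−1> = −η` (from `η·h = 0`, `h = 1 + <−1>`). [cite: Morel2012, Ch. 3 Lemma 3.5, relation (4) «εη = η»] -/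
theorem eta_mul_angle_neg_one : eta K * angle K (-1) = -eta K := by
  rw [angle_def, mul_add, mul_one, ← mul_assoc, eta_mul_eta_mul_sym_neg_one, two_mul, neg_add, ← add_assoc,
    add_neg_cancel, zero_add]

/-- **`η·n_ε = 0` for even `n` and `η·n_ε = η` for odd `n`** (`n ∈ ℤ`): `n_ε` reduces to `n mod 2` after
multiplication by `η` (`η·h = 0`). [cite: Morel2012, Ch. 3 Lemma 3.14, Remark 3.26] -/
theorem eta_mul_zneps (n : ℤ) : eta K * zneps K n = if Even n then 0 else eta K := by
  induction n using Int.induction_on with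
  | zero => rw [zneps_zero, mul_zero, if_pos Even.zero]
  | succ n ih =>
    rw [zneps_add_one, mul_add, mul_one, ← mul_assoc, eta_mul_angle_neg_one, neg_mul, ih]
    by_cases h : Even (n : ℤ)
    · rw [if_pos h, if_neg (Int.not_even_iff_odd.2 (Even.add_one h)), neg_zero, zero_add]
    · rw [if_neg h, if_pos (Int.not_even_iff_odd.1 h).add_one, neg_add_cancel]
  | pred n ih =>
    rw [zneps_sub_one, ← mul_assoc, eta_mul_angle_neg_one, neg_mul, mul_sub, mul_one, ih]
    by_cases h : Even (-(n : ℤ))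
    · rw [if_pos h, if_neg (Int.not_even_iff_odd.2 (Even.sub_odd h odd_one)), zero_sub, neg_neg]
    · rw [if_neg h, if_pos (Odd.sub_odd (Int.not_even_iff_odd.1 h) odd_one), sub_self, neg_zero]

/-- `ηᵐ⁺¹·n_ε = 0` for even `n`. [cite: Morel2012, Ch. 3 Remark 3.26] -/
theorem eta_pow_succ_mul_zneps_of_even (m : ℕ) {n : ℤ} (hn : Even n) : eta K ^ (m + 1) * zneps K n = 0 := by
  rw [pow_succ, mul_assoc, eta_mul_zneps, if_pos hn, mul_zero]

/-- `ηᵐ⁺¹·n_ε = ηᵐ⁺¹` for odd `n`. [cite: Morel2012, Ch. 3 Remark 3.26] -/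
theorem eta_pow_succ_mul_zneps_of_odd (m : ℕ) {n : ℤ} (hn : Odd n) : eta K ^ (m + 1) * zneps K n = eta K ^ (m + 1) := by
  rw [pow_succ, mul_assoc, eta_mul_zneps, if_neg (Int.not_even_iff_odd.2 hn)]

end EtaZneps

/-! ### §2 `∂^π_v ∘ φ_{−n} = φ_{−(n+1)} ∘ ∂_π`: Morel's residue in negative degrees is Milnor's second residue -/

section Comparison

variable {K : Type*} [Field K] (v : Valuation K (WithZero (Multiplicative ℤ))) {π : Kˣ} (hπ : addVal v π = 1)

/-- `∂^π_v(<x>) = η·v(x)_ε·<x̄′>` (`x̄′` the residue of the unit part of `x`). [cite: Morel2012, Ch. 3 Theorem 3.15, Lemma 3.16 «Θ_π(πⁿ.u) := [ū] + (n_ε<ū>).ξ»] -/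
theorem residue_angle (x : Kˣ) :
    residue v hπ (angle K x) = eta _ * zneps _ (addVal v x) * angle _ (res v hπ x) := by
  rw [angle_def, map_add, residue_one, zero_add, residue_eta_mul, residue_sym, mul_assoc]

/-- **`∂^π_v(ηⁿ<x>)`: `0` if `v(x)` is even, `ηⁿ⁺¹<x̄′>` if `v(x)` is odd.** [cite: Morel2012, Ch. 3 Theorem 3.15, Remark 3.26] -/
theorem residue_eta_pow_mul_angle (n : ℕ) (x : Kˣ) :
    residue v hπ (eta K ^ n * angle K x) = if Even (addVal v x) then 0 else eta _ ^ (n + 1) * angle _ (res v hπ x) := by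
  rw [residue_eta_pow_mul, residue_angle, ← mul_assoc, ← mul_assoc, ← pow_succ]
  by_cases h : Even (addVal v x)
  · rw [if_pos h, eta_pow_succ_mul_zneps_of_even _ n h, zero_mul]
  · rw [if_neg h, eta_pow_succ_mul_zneps_of_odd _ n (Int.not_even_iff_odd.1 h)]

/-- **REMARK 3.26 (the residues): Morel's `∂^π_v` on `K^MW_{−n}(K) = φ_{−n}(W(K))` (`n ≥ 1`) is Milnor's second residue
class form homomorphism `∂_π : W(K) → W(κ(v))` on `K^MW_{−n−1}(κ(v)) = φ_{−(n+1)}(W(κ(v)))`: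
`∂^π_v(φ_{−n}(w)) = φ_{−(n+1)}(∂_π(w))`.** [cite: Morel2012, Ch. 3 Remark 3.26 «the previous theorem in negative degrees is exactly [53, Theorem 5.3]»; Milnor1970, §5 Corollary 5.1 «∂(πu) = (ū), ∂(u) = 0»] -/
theorem residue_phiNeg {n : ℕ} (hn : 0 < n) (w : WittRing K) :
    residue v hπ (phiNeg K hn w) = phiNeg (ValResidueField v) (Nat.succ_pos n) (WittRing.sndResidue v hπ w) := by
  have h : (residue v hπ).comp (phiNeg K hn) =
      (phiNeg (ValResidueField v) (Nat.succ_pos n)).comp (WittRing.sndResidue v hπ) := by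
    refine WittRing.addMonoidHom_ext _ fun x => ?_
    rw [AddMonoidHom.comp_apply, AddMonoidHom.comp_apply, phiNeg_gen, residue_eta_pow_mul_angle]
    by_cases hx : Even (addVal v x)
    · rw [if_pos hx, WittRing.sndResidue_gen_of_even v hπ hx, map_zero]
    · rw [if_neg hx, WittRing.sndResidue_gen_of_odd v hπ (Int.not_even_iff_odd.1 hx), phiNeg_gen]
  exact DFunLike.congr_fun h w

end Comparison

/-! ### §3 The case of `F(T)`: THEOREM 3.24 in degree `−n` and Milnor's THEOREM 5.3 -/

section RatFunc

variable (F : Type*) [Field F]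

/-- **The constants commute with `φ_{−n}`: `ι(φ_{−n}(w)) = φ_{−n}(ι_W(w))`** (`ι : K^MW_*(F) → K^MW_*(F(T))`,
`ι_W : W(F) → W(F(T))`). [cite: Morel2012, Ch. 3 Theorem 3.24, Remark 3.26; Milnor1970, §5 Theorem 5.3] -/
theorem constMap_phiNeg {n : ℕ} (hn : 0 < n) (w : WittRing F) :
    constMap F (phiNeg F hn w) = phiNeg (RatFunc F) hn (WittRing.constMapW F w) := by
  have h : (constMap F).toAddMonoidHom.comp (phiNeg F hn) = (phiNeg (RatFunc F) hn).comp (WittRing.constMapW F).toAddMonoidHom := by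
    refine WittRing.addMonoidHom_ext _ fun a => ?_
    rw [AddMonoidHom.comp_apply, AddMonoidHom.comp_apply, RingHom.toAddMonoidHom_eq_coe, RingHom.toAddMonoidHom_eq_coe,
      AddMonoidHom.coe_coe, AddMonoidHom.coe_coe, phiNeg_gen, map_mul, map_pow, constMap_eta, constMap, map_angle,
      map_algebraMap_eq_polyUnit_C, WittRing.constMapW_gen, phiNeg_gen]
  exact DFunLike.congr_fun h w

/-- The two inverses of `F ≅ κ_{(T)}` agree: `(g mod T ↦ g(0)) ∘ (κ_{(T)} ≅ F[T]/(T)) = (constResidueEquiv)⁻¹`.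
[cite: Morel2012, Ch. 3 proof of Theorem 3.24 «provides a retraction» (p. 62); Milnor1970, §5 Theorem 5.3] -/
theorem evalZeroHom_comp_symm_eq :
    (MilnorK.evalZeroHom F).comp (quotientEquivResidueFieldAt F[X] (RatFunc F) (MilnorK.primeT F)).symm.toRingHom =
      (WittRing.constResidueEquiv F).symm.toRingHom := by
  refine RingHom.ext fun y => ?_
  obtain ⟨a, rfl⟩ := (WittRing.constResidueEquiv F).surjective y
  change MilnorK.evalZeroHom F ((quotientEquivResidueFieldAt F[X] (RatFunc F) (MilnorK.primeT F)).symm (WittRing.constResidueEquiv F a)) =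
    (WittRing.constResidueEquiv F).symm (WittRing.constResidueEquiv F a)
  rw [RingEquiv.symm_apply_apply, WittRing.constResidueEquiv_apply, WittRing.constResidue_apply,
    ← quotientEquivResidueFieldAt_mk, RingEquiv.symm_apply_apply, MilnorK.evalZeroHom_mk, eval_C]

/-- **The retractions commute with `φ_{−n}`: `ψ(φ_{−n}(w)) = φ_{−n}(r_W(w))`** (`ψ = psiRat` Morel's retraction through
`s^T_{(T)}`, `r_W = WittRing.retraction` Milnor's through `ρ` at `(T)`). [cite: Morel2012, Ch. 3 Theorem 3.24 «(split)», Remark 3.26; Milnor1970, §5 Theorem 5.3] -/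
theorem psiRat_phiNeg {n : ℕ} (hn : 0 < n) (w : WittRing (RatFunc F)) :
    psiRat F (phiNeg (RatFunc F) hn w) = phiNeg F hn (WittRing.retraction F w) := by
  have h : (psiRat F).toAddMonoidHom.comp (phiNeg (RatFunc F) hn) = (phiNeg F hn).comp (WittRing.retraction F).toAddMonoidHom := by
    refine WittRing.addMonoidHom_ext _ fun x => ?_
    rw [AddMonoidHom.comp_apply, AddMonoidHom.comp_apply, RingHom.toAddMonoidHom_eq_coe, RingHom.toAddMonoidHom_eq_coe,
      AddMonoidHom.coe_coe, AddMonoidHom.coe_coe, phiNeg_gen, map_mul, map_pow, psiRat_eta, psiRat_apply, spec_angle,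
      map_angle, WittRing.retraction, RingHom.comp_apply, WittRing.rhoT_def, WittRing.rho_gen, WittRing.map_gen, phiNeg_gen,
      ← evalZeroHom_comp_symm_eq]
  exact DFunLike.congr_fun h w

variable {F}

/-- **REMARK 3.26 for `F(T)`: `∂^P ∘ φ_{−n} = φ_{−(n+1)} ∘ ∂_P`** with Milnor's second residue `∂_P : W(F(T)) → W(κ_P)`
of the `P`-adic valuation (the tree's `WittRing.boundaryAtW`, the maps of Milnor's THEOREM 5.3).
[cite: Morel2012, Ch. 3 Remark 3.26; Milnor1970, §5 Theorem 5.3] -/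
theorem ratResidue_phiNeg {n : ℕ} (hn : 0 < n) (v : HeightOneSpectrum F[X]) (w : WittRing (RatFunc F)) :
    ratResidue v (phiNeg (RatFunc F) hn w) =
      phiNeg (ValResidueField (v.valuation (RatFunc F))) (Nat.succ_pos n) (WittRing.boundaryAtW F v w) := by
  rw [ratResidue_apply, residue_phiNeg, WittRing.boundaryAtW_def]

/-- **THEOREM 3.24 in degree `−n` versus Milnor's THEOREM 5.3, exactness in the middle**: for `w ∈ W(F(T))`, all
`∂^P(φ_{−n} w)` vanish iff all of Milnor's `∂_P(w)` vanish (`φ_{−(n+1)}` is injective), iff `w` comes from `W(F)`.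
[cite: Morel2012, Ch. 3 Remark 3.26; Milnor1970, §5 Theorem 5.3] -/
theorem forall_ratResidue_phiNeg_eq_zero_iff {n : ℕ} (hn : 0 < n) (w : WittRing (RatFunc F)) :
    (∀ v : HeightOneSpectrum F[X], ratResidue v (phiNeg (RatFunc F) hn w) = 0) ↔
      ∀ v : HeightOneSpectrum F[X], WittRing.boundaryAtW F v w = 0 := by
  refine forall_congr' fun v => ?_
  rw [ratResidue_phiNeg, ← map_zero (phiNeg (ValResidueField (v.valuation (RatFunc F))) (Nat.succ_pos n))]
  exact (phiNeg_injective _ (Nat.succ_pos n)).eq_iff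

/-- **… and both say that `φ_{−n}(w)` (equivalently `w`) is constant.** [cite: Morel2012, Ch. 3 Theorem 3.24, Remark 3.26; Milnor1970, §5 Theorem 5.3] -/
theorem forall_boundaryAtW_eq_zero_iff_exists_constMap {n : ℕ} (hn : 0 < n) (w : WittRing (RatFunc F)) :
    (∀ v : HeightOneSpectrum F[X], WittRing.boundaryAtW F v w = 0) ↔ ∃ w₀ : WittRing F, constMap F (phiNeg F hn w₀) = phiNeg (RatFunc F) hn w := by
  rw [← forall_ratResidue_phiNeg_eq_zero_iff hn, forall_ratResidue_eq_zero_iff]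
  constructor
  · rintro ⟨x, hx⟩
    -- `x` is homogeneous of degree `−n` (it is `ψ` of a homogeneous element), hence `x = φ_{−n}(w₀)`
    have hxdeg : x ∈ deg F (-(n : ℤ)) := by
      rw [← psiRat_constMap x, hx]
      exact psiRat_mem_deg (phiNeg_mem_deg _ hn w)
    obtain ⟨w₀, rfl⟩ := phiNeg_surjOn F hn hxdeg
    exact ⟨w₀, hx⟩
  · rintro ⟨w₀, hw₀⟩
    exact ⟨phiNeg F hn w₀, hw₀⟩

/-- **Milnor's THEOREM 5.3, surjectivity, from THEOREM 3.24 in degree `−n`** («exactly [53, Theorem 5.3]»): every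
finitely supported family `(e_P)`, `e_P ∈ W(κ_P)`, is `(∂_P w)_P` for some `w ∈ W(F(T))` — lift `(φ_{−(n+1)} e_P)_P`
homogeneously by Theorem 3.24, write the lift as `φ_{−n}(w)`, and cancel `φ_{−(n+1)}`.
[cite: Morel2012, Ch. 3 Remark 3.26; Milnor1970, §5 Theorem 5.3] -/
theorem exists_forall_boundaryAtW_eq_of_ratResidue {n : ℕ} (hn : 0 < n)
    (e : (v : HeightOneSpectrum F[X]) → WittRing (ValResidueField (v.valuation (RatFunc F)))) (he : {v | e v ≠ 0}.Finite) :
    ∃ w : WittRing (RatFunc F), ∀ v, WittRing.boundaryAtW F v w = e v := by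
  obtain ⟨u, hu, hue⟩ := exists_mem_deg_forall_ratResidue_eq (F := F) (-(n : ℤ))
    (fun v => phiNeg (ValResidueField (v.valuation (RatFunc F))) (Nat.succ_pos n) (e v))
    (he.subset fun v hv => by
      intro h0
      exact hv (by rw [h0, map_zero]))
    (fun v => by
      have h := phiNeg_mem_deg (ValResidueField (v.valuation (RatFunc F))) (Nat.succ_pos n) (e v)
      rwa [show (-((n + 1 : ℕ) : ℤ)) = -(n : ℤ) - 1 by push_cast; ring] at h)
  obtain ⟨w, rfl⟩ := phiNeg_surjOn (RatFunc F) hn hu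
  refine ⟨w, fun v => phiNeg_injective _ (Nat.succ_pos n) ?_⟩
  rw [← ratResidue_phiNeg hn, hue]

/-- **The two exact sequences determine each other**: `(∂_P w)_P = (e_P)_P` in Milnor's THEOREM 5.3 iff
`(∂^P φ_{−n} w)_P = (φ_{−(n+1)} e_P)_P` in THEOREM 3.24. [cite: Morel2012, Ch. 3 Remark 3.26; Milnor1970, §5 Theorem 5.3] -/
theorem forall_boundaryAtW_eq_iff {n : ℕ} (hn : 0 < n) (w : WittRing (RatFunc F))
    (e : (v : HeightOneSpectrum F[X]) → WittRing (ValResidueField (v.valuation (RatFunc F)))) :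
    (∀ v, WittRing.boundaryAtW F v w = e v) ↔
      ∀ v, ratResidue v (phiNeg (RatFunc F) hn w) = phiNeg (ValResidueField (v.valuation (RatFunc F))) (Nat.succ_pos n) (e v) := by
  refine forall_congr' fun v => ?_
  rw [ratResidue_phiNeg]
  exact ((phiNeg_injective _ (Nat.succ_pos n)).eq_iff).symm

end RatFunc

/-! ### §4 Milnor's THEOREM 5.3 in every characteristic -/

section AllCharacteristics

variable {F : Type*} [Field F]

/-- **THEOREM 5.3 (Milnor), EXACTNESS AT `W(F(t))`, WITHOUT THE HYPOTHESIS `char F ≠ 2`** of the tree's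
`WittRing.forall_boundaryAtW_eq_zero_iff` (whose Lemma 5.6 needed `2 ≠ 0`): `∂_P w = 0` for all `P` iff `w` comes from
`W(F)` — through `φ_{−1} : W ≅ K^MW_{−1}` and THEOREM 3.24. [cite: Morel2012, Ch. 3 Remark 3.26, Theorem 3.24; Milnor1970, §5 Theorem 5.3] -/
theorem witt_forall_boundaryAtW_eq_zero_iff (w : WittRing (RatFunc F)) :
    (∀ v : HeightOneSpectrum F[X], WittRing.boundaryAtW F v w = 0) ↔ ∃ b : WittRing F, WittRing.constMapW F b = w := by
  rw [forall_boundaryAtW_eq_zero_iff_exists_constMap Nat.one_pos]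
  refine ⟨?_, ?_⟩
  · rintro ⟨b, hb⟩
    rw [constMap_phiNeg] at hb
    exact ⟨b, phiNeg_injective _ Nat.one_pos hb⟩
  · rintro ⟨b, rfl⟩
    exact ⟨b, constMap_phiNeg F Nat.one_pos b⟩

/-- **THEOREM 5.3 (Milnor's split exact sequence `0 → W(F) → W(F(t)) → ⊕_P W(κ_P) → 0`) in every characteristic**:
`w ↦ (r_W w, (∂_P w)_P)` is a bijection `W(F(t)) → W(F) × ⊕_P W(κ_P)` (the tree's
`WittRing.bijective_retraction_prod_boundaryFamilyW` assumes `char F ≠ 2`). [cite: Morel2012, Ch. 3 Remark 3.26, Theorem 3.24; Milnor1970, §5 Theorem 5.3] -/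
theorem witt_bijective_retraction_prod_boundaryFamilyW :
    Function.Bijective fun w : WittRing (RatFunc F) => (WittRing.retraction F w, WittRing.boundaryFamilyW F w) := by
  constructor
  · intro z₁ z₂ h
    simp only [Prod.mk.injEq] at h
    obtain ⟨h1, h₂⟩ := h
    have h0 : ∀ v, WittRing.boundaryAtW F v (z₁ - z₂) = 0 := fun v => by
      have := congrArg (fun e : WittRing.FinSuppFamilyW F => e.1 v) h₂
      simp only [WittRing.boundaryFamilyW_apply] at this
      rw [map_sub, this, sub_self]
    obtain ⟨b, hb⟩ := (witt_forall_boundaryAtW_eq_zero_iff _).1 h0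
    have hb0 : b = 0 := by
      have := congrArg (WittRing.retraction F) hb
      rwa [WittRing.retraction_constMapW, map_sub, h1, sub_self] at this
    rw [hb0, map_zero] at hb
    exact sub_eq_zero.1 hb.symm
  · rintro ⟨β, e⟩
    obtain ⟨u, hu⟩ := exists_forall_boundaryAtW_eq_of_ratResidue (F := F) Nat.one_pos e.1 e.2
    refine ⟨u + WittRing.constMapW F (β - WittRing.retraction F u), ?_⟩
    simp only [Prod.mk.injEq]
    refine ⟨by rw [map_add, WittRing.retraction_constMapW, add_sub_cancel], Subtype.ext (funext fun v => ?_)⟩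
    rw [WittRing.boundaryFamilyW_apply, map_add, WittRing.boundaryAtW_constMapW, add_zero, hu]

/-- `W(F(t)) = ι(W(F)) ⊕ ker r_W` with `ker r_W ≅ ⊕_P W(κ_P)`, in every characteristic («both kernel and cokernel turn out
to be isomorphic to WF»). [cite: Morel2012, Ch. 3 Remark 3.26; Milnor1970, §5 Theorem 5.3 and the Remark after it] -/
theorem witt_existsUnique_retraction_eq_zero_and_boundaryFamilyW_eq (e : WittRing.FinSuppFamilyW F) :
    ∃! u : WittRing (RatFunc F), WittRing.retraction F u = 0 ∧ WittRing.boundaryFamilyW F u = e := by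
  obtain ⟨u, hu⟩ := (witt_bijective_retraction_prod_boundaryFamilyW (F := F)).2 (0, e)
  simp only [Prod.mk.injEq] at hu
  refine ⟨u, hu, fun u' hu' => (witt_bijective_retraction_prod_boundaryFamilyW (F := F)).1 ?_⟩
  simp only [Prod.mk.injEq]
  exact ⟨hu'.1.trans hu.1.symm, hu'.2.trans hu.2.symm⟩

end AllCharacteristics

/-! ### §5 Milnor's LEMMA 5.7 (`0 → IⁿF → IⁿF(t) → ⊕_P Iⁿ⁻¹(κ_P) → 0`) in every characteristic -/

section IdealPowers

variable {F : Type*} [Field F]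

/-- **LEMMA 5.7 (Milnor), EXACTNESS IN THE MIDDLE, WITHOUT `char F ≠ 2`**: an element of `IⁿF(t)` killed by every
`∂_P` is `ι(ζ)` with `ζ ∈ IⁿF` (the tree's `WittRing.exists_mem_pow_constMapW_eq` assumes `(2 : F) ≠ 0` only through
Theorem 5.3). [cite: Milnor1970, §5 Lemma 5.7 and its proof «According to 5.3, ξ comes from some element ζ of WF … ρ(ξ) = ζ»; Morel2012, Ch. 3 Remark 3.26] -/
theorem witt_exists_mem_pow_constMapW_eq {n : ℕ} {ξ : WittRing (RatFunc F)}
    (hξ : ξ ∈ WittRing.fundIdeal (RatFunc F) ^ n) (h0 : ∀ v : HeightOneSpectrum F[X], WittRing.boundaryAtW F v ξ = 0) :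
    ∃ ζ ∈ WittRing.fundIdeal F ^ n, WittRing.constMapW F ζ = ξ := by
  obtain ⟨ζ, rfl⟩ := (witt_forall_boundaryAtW_eq_zero_iff ξ).1 h0
  exact ⟨ζ, (WittRing.mem_pow_iff_constMapW_mem_pow n ζ).1 hξ, rfl⟩

/-- **LEMMA 5.7 packaged, in every characteristic**: `w ↦ (r_W w, (∂_P w)_P)` restricts to a bijection from `Iⁿ⁺¹F(t)`
onto `Iⁿ⁺¹F × ⊕_P Iⁿ(κ_P)` (the tree's `WittRing.bijOn_pow_retraction_prod_boundaryFamilyW` assumes `(2 : F) ≠ 0`).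
[cite: Milnor1970, §5 Lemma 5.7 and its proof; Morel2012, Ch. 3 Remark 3.26] -/
theorem witt_bijOn_pow_retraction_prod_boundaryFamilyW (n : ℕ) :
    Set.BijOn (fun w : WittRing (RatFunc F) => (WittRing.retraction F w, WittRing.boundaryFamilyW F w))
      (WittRing.fundIdeal (RatFunc F) ^ (n + 1) : Ideal (WittRing (RatFunc F)))
      ((WittRing.fundIdeal F ^ (n + 1) : Ideal (WittRing F)) ×ˢ
        {e : WittRing.FinSuppFamilyW F | ∀ v, e.1 v ∈ WittRing.fundIdeal (ResidueFieldAt F[X] (RatFunc F) v) ^ n}) := by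
  refine ⟨fun w hw => ?_, fun w₁ _ w₂ _ h => (witt_bijective_retraction_prod_boundaryFamilyW (F := F)).1 h, fun p hp => ?_⟩
  · exact ⟨WittRing.retraction_mem_pow F hw, fun v => WittRing.boundaryAtW_mem_pow F v hw⟩
  · obtain ⟨β, e⟩ := p
    obtain ⟨hβ, he⟩ := hp
    obtain ⟨u, huI, hu⟩ := WittRing.exists_mem_pow_forall_boundaryAtW_eq n e.1 e.2 he
    refine ⟨u + WittRing.constMapW F (β - WittRing.retraction F u),
      add_mem huI (WittRing.constMapW_mem_pow F (sub_mem hβ (WittRing.retraction_mem_pow F huI))), ?_⟩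
    simp only [Prod.mk.injEq]
    refine ⟨by rw [map_add, WittRing.retraction_constMapW, add_sub_cancel], Subtype.ext (funext fun v => ?_)⟩
    rw [WittRing.boundaryFamilyW_apply, map_add, WittRing.boundaryAtW_constMapW, add_zero, hu]

end IdealPowers

end MilnorWittK

end Literature.RingTheory.KTheory
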